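import Summits.Ventures.Crystal3D.Theorems.StickyWulffConstantTextureLiminfLineCountGlueOneSidedUp
import Summits.Ventures.Crystal3D.Theorems.StickyWulffConstantGenericWallFloorBarlowOrientedGlueOneSidedTopAt
import HarnessLib

/-!
# The covered wall cell from the chosen-slot K1a, TOP plate (by-name twin of `bilayerWallAt_of_K1a_at`)
# (lane T, crux `TextureLiminfV5`, stmt-Ventures-23912; cf-p1 ruling 2026-08-29T03:15:18Z (a) / 03:35:17Z)

HONEST FRAMING. Venture `Summits/Ventures/Crystal3D` (cell `crystal3d-full`), route `route-Ventures-StickyWulffConstant`, helper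
`--supports` the law-v5 crux `TextureLiminfV5` (stmt-Ventures-23912).  A composition by name, standard axioms; nothing about any wall law
is claimed beyond the stated implication; rung F-C1 not moved.

* **`bilayerWallAt_of_K1a_top_at`** — lane G's DOWN chosen-slot ledger half `barlow_hlines_oriented_oneSided_top_at` (19480-p2 p692835:
  plate 2 up-presented toward `−e₃`, chosen Δ-slot `v` rising `⟪L₂ v, −e₃⟫ ≥ √2/2`, clause (ii) of `FramesApart` for `chainFrames (−e₃) L₂ v`,
  `R₀ ≥ 6`) composed with `bilayerWallAt_of_lineCount_oneSided_up_top` (…LineCountGlueOneSidedUp): every nonnegative table with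
  `c i j ≤ √2·(if σ₂ j = 1 then ⟪L₂ v, −e₃⟫ else bilayerRise L₂ σ₂ (−e₃) j)/2` satisfies
  `BilayerWallAt ((318 + 192R₀ + 80(R₀+9) + 3456 + 1152(R₀+1))/2) R₀ σ₁ σ₂ L₁ L₂ s₁ s₂ c`.
With …LineCountGlueOneSided (canonical slot, UP/DOWN) and …LineCountGlueOneSidedUp (chosen slot, UP) this completes the T-side of K1a for
steering `e₃`: {UP, DOWN} × {canonical, chosen}.
WHAT THIS IS NOT: no proof of any wall law or of any registered stub; F-C1 not moved.
-/

noncomputable section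

namespace Summit.Ventures.Crystal3D.Theorems

open MeasureTheory Set
open scoped ENNReal InnerProductSpace
open Literature.MathematicalPhysics.StatisticalMechanics (IsHaggSeq fccStacking)
open Summit.Ventures.Crystal3D.Cruxes.TextureLiminf.TexShadow (E3 e₃ bilayerRise BilayerWallAt)

/-- **K1a-top-at ⇒ the covered cell, top plate, CHOSEN slot `v`.**  Under lane G's E1 and star facts, for plate 2 up-presented toward `−e₃`
(`0 ≤ (L₂⁻¹(−e₃))₂`) and a Δ-slot `v ∈ fccSlots` with `v₂ = √(2/3)` rising `⟪L₂ v, −e₃⟫ ≥ √2/2`, whose walker chain frames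
`chainFrames (−e₃) L₂ v` are all distinct from plate 1's frame and its twin, and `R₀ ≥ 6`: every nonnegative table dominated by half the
chosen flux of plate 2 — `c i j ≤ √2·(if σ₂ j = 1 then ⟪L₂ v, −e₃⟫ else bilayerRise L₂ σ₂ (−e₃) j)/2` — satisfies
`BilayerWallAt ((318 + 192R₀ + 80(R₀+9) + 3456 + 1152(R₀+1))/2) R₀ σ₁ σ₂ L₁ L₂ s₁ s₂ c`. -/
theorem bilayerWallAt_of_K1a_top_at {sE : E3} (hsE : sE ∈ fccSlots) (hcert : ExactOnly 0 (fccSlots.filter fun w => 0 < ⟪w, sE⟫_ℝ))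
    (hDS : ∀ F₁ F₂ : E3 ≃ₗᵢ[ℝ] E3, DoubleStarCoaxialAt F₁ F₂) (hCP : CapPairCoaxial)
    {σ₁ σ₂ : ℤ → ℤ} (hσ₁ : IsHaggSeq σ₁) (hσ₂ : IsHaggSeq σ₂) (L₁ L₂ : E3 ≃ₗᵢ[ℝ] E3) (s₁ s₂ : E3)
    (hax₂ : 0 ≤ (L₂.symm (-e₃)) 2) {v : E3} (hv : v ∈ fccSlots) (hv2 : v 2 = Real.sqrt (2 / 3))
    (hsteep₂ : Real.sqrt 2 / 2 ≤ ⟪L₂ v, -e₃⟫_ℝ)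
    (hapart₂ : ∀ F ∈ chainFrames (-e₃) L₂ v,
      F '' fccStacking 1 (Real.sqrt (2 / 3)) ≠ L₁ '' fccStacking 1 (Real.sqrt (2 / 3)) ∧
      F '' fccStacking 1 (Real.sqrt (2 / 3)) ≠ (twinFrame L₁ (L₁ e₃)) '' fccStacking 1 (Real.sqrt (2 / 3)))
    (R₀ : ℝ) (hR₀ : 6 ≤ R₀) (c : ℤ → ℤ → ℝ) (hc0 : ∀ i j, 0 ≤ c i j)
    (hdom : ∀ i j, c i j ≤ Real.sqrt 2 * (if σ₂ j = 1 then ⟪L₂ v, -e₃⟫_ℝ else bilayerRise L₂ σ₂ (-e₃) j) / 2) :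
    BilayerWallAt ((318 + 192 * R₀ + 80 * (R₀ + 9) + 3456 + 1152 * (R₀ + 1)) / 2) R₀ σ₁ σ₂ L₁ L₂ s₁ s₂ c := by
  have he₃ : ‖(e₃ : E3)‖ = 1 := by rw [e₃, PiLp.norm_single, norm_one]
  have hne₃ : ‖(-e₃ : E3)‖ = 1 := by rw [norm_neg, he₃]
  obtain ⟨step₂, hup₂, hΔ, hnab, hF⟩ :=
    barlow_hlines_oriented_oneSided_top_at hsE hcert hDS hCP hσ₁ hσ₂ L₁ L₂ s₁ s₂ hax₂ hv hv2 hsteep₂ hapart₂ R₀ hR₀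
  -- the rise of the chosen steps: `⟪L₂ v, −e₃⟫` on Δ-bilayers, `bilayerRise` on ∇-bilayers
  have hrise : ∀ j, ⟪step₂ j, L₂.symm (-e₃)⟫_ℝ = if σ₂ j = 1 then ⟪L₂ v, -e₃⟫_ℝ else bilayerRise L₂ σ₂ (-e₃) j := by
    intro j
    rcases hσ₂ j with h1 | h1
    · rw [if_pos h1, hΔ j h1, ← LinearIsometryEquiv.inner_map_map L₂ v (L₂.symm (-e₃)), LinearIsometryEquiv.apply_symm_apply]
    · rw [if_neg (by omega)]; exact hnab j h1
  have h12 : (1 : ℝ) ≤ Real.sqrt 2 := by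
    rw [show (1 : ℝ) = Real.sqrt 1 by simp]; exact Real.sqrt_le_sqrt (by norm_num)
  have hr₂ : ∀ k, (1 / 4 : ℝ) ≤ ⟪step₂ k, L₂.symm (-e₃)⟫_ℝ := by
    intro k
    rw [hrise k]
    split_ifs with h1
    · linarith
    · exact quarter_le_bilayerRise L₂ σ₂ hne₃ k
  have hdom' : ∀ i j, c i j ≤ Real.sqrt 2 * ⟪step₂ j, L₂.symm (-e₃)⟫_ℝ / 2 := fun i j => by rw [hrise j]; exact hdom i j
  exact bilayerWallAt_of_lineCount_oneSided_up_top hσ₁ hσ₂ L₁ L₂ s₁ s₂ R₀ (318 + 192 * R₀) (by linarith) hax₂ hup₂ hr₂ c hc0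
    hdom' hF

end Summit.Ventures.Crystal3D.Theorems

end
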